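import Summits.QuantumFields.YangMills.Theorems.UnitScaleTiltProp7OrderedProductExpansion
import HarnessLib

/-!
# Route `UnitScaleTilt`, crux K1 child «MinimiserStabilityRegPr» (stmt-QuantumFields-19200), line «route-R», growth side (stub S ∕ row E′) —
# THE COMMUTATOR PAIR SUM OF A CONCATENATED ∕ REVERSED WORD, AND THE THREE-PIECE SPLIT `C(F·S·F′⁻¹) = C(S) + (C(F) − C(F′)) − [ΣF, ΣF′ − ΣF] + [ΣF + ΣF′, ΣS]`

Cell `ym3-torus`, twin width seat `ym-routeR-w1` (g3); row (w1-o1′) NAMED by the route-R lead `ym-ust-19200-p1` (g13, bus 2026-08-28T13:33:15Z).  THEOREMS ONLY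
(0 `def`, 0 `sorry`); `--supports stmt-QuantumFields-19200 --as helper`, count-neutral.  YM₃ on T³ is a ladder rung (R3), not the Clay problem; nothing here
claims stub S, row E′, the crux or the gap.

WHY.  The JOINT remainder row of the growth-side door (✓ `Prop7LocMinOfJointRow.linRow_of_QRows` ∕ `Prop7LocMinOfMultiplierRows`) needs the second-order source
of the one-step symmetric (0.4) average in `(mass, gradient)` currency.  In exp-mean-log letters at a flat word the only second-order survivor is half the ORDERED
COMMUTATOR PAIR SUM `C(A) = Σ_{i<j}(A_iA_j − A_jA_i)` of the transported letters along the word (✓ `Prop7OrderedProductExpansion.two_smul_pairSum_eq`), and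
✓ `Prop7OrderedProductExpansion.norm_commSum_le_mass_mul_osc` charges `C` by MASS × OSCILLATION.  Along a symmetric (0.4) word `w = F · S · F′⁻¹` (forward
staircase `F`, straight segment `S` of `L` bonds, translated staircase `F′` backwards; [Balaban1987RG1] (0.3)–(0.4)) the oscillation is NOT a gradient at the
staircase corners (the lead's CORRECTION of 13:33:15Z), so the mass × oscillation mechanism must be applied PIECEWISE.  The piecewise bookkeeping is pure ring
algebra: `C(u ⧺ v) = C(u) + C(v) + [Σu, Σv]`, `C(rev(−u)) = −C(u)` (✓ `Prop7OrderedProductExpansion.commSum_append` ∕ `commSum_rev_neg`, the lead's §5), whence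
  `C(F ⧺ S ⧺ rev(−F′)) = C(S) + (C(F) − C(F′)) − [ΣF, ΣF′ − ΣF] + [ΣF + ΣF′, ΣS]`:
(i) `C(S)` — same-direction letters (mass × LONGITUDINAL oscillation); (ii) `C(F) − C(F′)`, `[ΣF, ΣF′ − ΣF]` — bilinear DIFFERENCES between the leg and its
translate (mass × translate differences, `norm_commSum_sub_commSum_le`, `norm_comm_sub_le`); (iii) `[ΣF + ΣF′, ΣS]` — odd under the reflection of the offset, left
to the symmetric mean (consumer).  With the closing axis `a` of the loop word of (0.4) (`loopWord = F ⧺ S ⧺ rev F′ ⧺ rev a`, ✓ `BlockAveraging.loopWord`) the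
four-piece form and the formal second-order cancellation of the axis against the BCH cross term are recorded too (`commSum_fourPiece`, `axis_cancellation`).

WHAT IS PROVED (ns `…Theorems.Prop7WordCommutatorSplit`; any ring `R`; the commutator sum written out as in ✓ `Prop7OrderedProductExpansion`:
`Σ_iΣ_j (if i<j then A_iA_j − A_jA_i else 0)`; concatenation = `Fin.append`, reversal = `Fin.rev`).
* §1 `sum_append`, `sum_rev_neg` (the letter sums; the commutator-sum twins `commSum_append` ∕ `commSum_rev_neg` are the lead's ✓ `Prop7OrderedProductExpansion` §5,
  p637778, imported — not restated).
* §2 ★★ `commSum_threePiece`, `sum_threePiece`, `commSum_fourPiece`, `sum_fourPiece`, `axis_cancellation`.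
* §3 (normed ring) `norm_comm_le`, ★ `norm_commSum_sub_commSum_le` (`‖C(A) − C(A′)‖ ≤ 2·(Σ‖A_i − A′_i‖)·(Σ‖A_i‖ + Σ‖A′_i‖)`), `norm_comm_sub_le`
  (`‖[ΣA, ΣA′ − ΣA]‖ ≤ 2·(Σ‖A_i‖)·(Σ‖A′_i − A_i‖)`), `norm_comm_sum_le` (`‖[ΣA + ΣA′, ΣS]‖ ≤ 2·(Σ‖A_i‖ + Σ‖A′_i‖)·‖ΣS‖`).
HONEST SCOPE.  Elementary algebra and the triangle inequality; no lattice object appears (the instantiation on the (0.4) word is the sequel file).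

References: T. Bałaban, CMP 109 (1987) 249–301 [Balaban1987RG1] ((0.3)–(0.4) pp.252–253, the symmetric averaging words); CMP 98 (1985) 17–51 [Balaban1985Averaging]
((19)–(23) p.21); CMP 102 (1985) 277–309 [Balaban1985Variational] ((141)–(143) p.299).
-/

noncomputable section

open scoped BigOperators

namespace Summit.QuantumFields.YangMills.Theorems.Prop7WordCommutatorSplit

open Finset
open Summit.QuantumFields.YangMills.Theorems.Prop7OrderedProductExpansion (commSum_append commSum_rev_neg)

variable {R : Type*} [NormedRing R]

/-! ## §1 Letter sums of a concatenation and of a negated reversal (the commutator-sum twins are the lead's §5) -/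

/-- The letter sum of a concatenated word is the sum of the letter sums. [folklore] -/
theorem sum_append {m n : ℕ} (A : Fin m → R) (B : Fin n → R) :
    ∑ i : Fin (m + n), Fin.append A B i = ∑ i : Fin m, A i + ∑ i : Fin n, B i := by
  rw [Fin.sum_univ_add]
  simp only [Fin.append_left, Fin.append_right]

/-- The letter sum of the negated reversed word is minus the letter sum. [folklore] -/
theorem sum_rev_neg {m : ℕ} (A : Fin m → R) :
    ∑ i : Fin m, (-A (Fin.rev i)) = -∑ i : Fin m, A i := by
  rw [Finset.sum_neg_distrib]
  congr 1
  exact Fintype.sum_equiv Fin.revPerm _ _ fun i => rfl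

/-! ## §2 The three-piece and four-piece splits of a symmetric (0.4) word -/

/-- The letter sum of `F ⧺ S ⧺ rev(−F′)` is `ΣF + ΣS − ΣF′`. [cite: Balaban1987RG1, (0.4) p.253] -/
theorem sum_threePiece {a b a' : ℕ} (F : Fin a → R) (S : Fin b → R) (F' : Fin a' → R) :
    ∑ i : Fin (a + b + a'), Fin.append (Fin.append F S) (fun i => -F' (Fin.rev i)) i
      = ∑ i : Fin a, F i + ∑ i : Fin b, S i - ∑ i : Fin a', F' i := by
  rw [sum_append, sum_append, sum_rev_neg, sub_eq_add_neg]

/-- ★★ **THE THREE-PIECE SPLIT** (route-R lead g13, 2026-08-28): for the word `F ⧺ S ⧺ rev(−F′)` (forward leg, straight segment, translated leg backwards),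
`C(F ⧺ S ⧺ rev(−F′)) = C(S) + (C(F) − C(F′)) − [ΣF, ΣF′ − ΣF] + [ΣF + ΣF′, ΣS]`.
Term (i) is same-direction (mass × longitudinal oscillation), the two terms (ii) are leg-vs-translate DIFFERENCES, term (iii) is odd under the reflection of the
offset and is left to the symmetric mean. [cite: Balaban1987RG1, (0.3)-(0.4) pp.252-253; Balaban1985Averaging, (19)-(23) p.21] -/
theorem commSum_threePiece {a b a' : ℕ} (F : Fin a → R) (S : Fin b → R) (F' : Fin a' → R) :
    (∑ i : Fin (a + b + a'), ∑ j : Fin (a + b + a'),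
        if i < j then Fin.append (Fin.append F S) (fun i => -F' (Fin.rev i)) i * Fin.append (Fin.append F S) (fun i => -F' (Fin.rev i)) j
          - Fin.append (Fin.append F S) (fun i => -F' (Fin.rev i)) j * Fin.append (Fin.append F S) (fun i => -F' (Fin.rev i)) i else 0)
      = (∑ i : Fin b, ∑ j : Fin b, if i < j then S i * S j - S j * S i else 0)
        + ((∑ i : Fin a, ∑ j : Fin a, if i < j then F i * F j - F j * F i else 0)
            - (∑ i : Fin a', ∑ j : Fin a', if i < j then F' i * F' j - F' j * F' i else 0))
        - ((∑ i : Fin a, F i) * (∑ i : Fin a', F' i - ∑ i : Fin a, F i) - (∑ i : Fin a', F' i - ∑ i : Fin a, F i) * (∑ i : Fin a, F i))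
        + ((∑ i : Fin a, F i + ∑ i : Fin a', F' i) * (∑ i : Fin b, S i) - (∑ i : Fin b, S i) * (∑ i : Fin a, F i + ∑ i : Fin a', F' i)) := by
  rw [commSum_append, commSum_append, commSum_rev_neg, sum_append, sum_rev_neg]
  noncomm_ring

/-- The letter sum of the full loop word `F ⧺ S ⧺ rev(−F′) ⧺ rev(−a)` (with the closing axis `a`) is `ΣF + ΣS − ΣF′ − Σa`. [cite: Balaban1987RG1, (0.4) p.253] -/
theorem sum_fourPiece {a b a' e : ℕ} (F : Fin a → R) (S : Fin b → R) (F' : Fin a' → R) (Ax : Fin e → R) :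
    ∑ i : Fin (a + b + a' + e), Fin.append (Fin.append (Fin.append F S) (fun i => -F' (Fin.rev i))) (fun i => -Ax (Fin.rev i)) i
      = ∑ i : Fin a, F i + ∑ i : Fin b, S i - ∑ i : Fin a', F' i - ∑ i : Fin e, Ax i := by
  rw [sum_append, sum_threePiece, sum_rev_neg, sub_eq_add_neg _ (∑ i : Fin e, Ax i)]

/-- **THE FOUR-PIECE SPLIT** of the closed loop word of (0.4) (`Γ ∪ [x,x′] ∪ (−Γ′) ∪ (−c)`, ✓ `BlockAveraging.loopWord`): with the closing axis `a`,
`C(F ⧺ S ⧺ rev(−F′) ⧺ rev(−a)) = C(F ⧺ S ⧺ rev(−F′)) − C(a) − [ΣF + ΣS − ΣF′, Σa]`. [cite: Balaban1987RG1, (0.4) p.253] -/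
theorem commSum_fourPiece {a b a' e : ℕ} (F : Fin a → R) (S : Fin b → R) (F' : Fin a' → R) (Ax : Fin e → R) :
    (∑ i : Fin (a + b + a' + e), ∑ j : Fin (a + b + a' + e),
        if i < j then
          Fin.append (Fin.append (Fin.append F S) (fun i => -F' (Fin.rev i))) (fun i => -Ax (Fin.rev i)) i
            * Fin.append (Fin.append (Fin.append F S) (fun i => -F' (Fin.rev i))) (fun i => -Ax (Fin.rev i)) j
          - Fin.append (Fin.append (Fin.append F S) (fun i => -F' (Fin.rev i))) (fun i => -Ax (Fin.rev i)) j
            * Fin.append (Fin.append (Fin.append F S) (fun i => -F' (Fin.rev i))) (fun i => -Ax (Fin.rev i)) i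
        else 0)
      = (∑ i : Fin (a + b + a'), ∑ j : Fin (a + b + a'),
          if i < j then Fin.append (Fin.append F S) (fun i => -F' (Fin.rev i)) i * Fin.append (Fin.append F S) (fun i => -F' (Fin.rev i)) j
            - Fin.append (Fin.append F S) (fun i => -F' (Fin.rev i)) j * Fin.append (Fin.append F S) (fun i => -F' (Fin.rev i)) i else 0)
        - (∑ i : Fin e, ∑ j : Fin e, if i < j then Ax i * Ax j - Ax j * Ax i else 0)
        - ((∑ i : Fin a, F i + ∑ i : Fin b, S i - ∑ i : Fin a', F' i) * (∑ i : Fin e, Ax i)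
            - (∑ i : Fin e, Ax i) * (∑ i : Fin a, F i + ∑ i : Fin b, S i - ∑ i : Fin a', F' i)) := by
  rw [commSum_append, commSum_rev_neg, sum_threePiece, sum_rev_neg]
  noncomm_ring

/-- **THE AXIS CANCELS AT SECOND ORDER** (formal bookkeeping for `M(U) = exp(mean log U(loop))·U(axis)`, [Balaban1987RG1] (0.4)): if the loop's letter sum is
`Σ₃ − Σa` and its commutator sum is `C₃ − C(a) − [Σ₃ − Σa, Σa]` (the four-piece split), then the three second-order contributions — half the loop's commutator
sum, half the axis' own, and the BCH cross term `½[Σloop, Σa]` — add up to `½C₃`: the second-order source of the symmetric average is half the (mean) commutator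
sum of the OPEN word `F·S·F′⁻¹` alone. [cite: Balaban1987RG1, (0.4) p.253] -/
theorem axis_cancellation (C₃ Ca S₃ Sa Cloop Sloop : R)
    (hS : Sloop = S₃ - Sa) (hC : Cloop = C₃ - Ca - ((S₃ - Sa) * Sa - Sa * (S₃ - Sa))) :
    Cloop + Ca + (Sloop * Sa - Sa * Sloop) = C₃ := by
  rw [hC, hS]
  noncomm_ring

/-! ## §3 The bounds for the leg-vs-translate pieces (ii) and the size of (iii), in a normed ring -/

section Normed

variable {S : Type*} [NormedRing S]

/-- `‖ab − ba‖ ≤ 2‖a‖‖b‖`. [folklore] -/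
theorem norm_comm_le (a b : S) : ‖a * b - b * a‖ ≤ 2 * ‖a‖ * ‖b‖ := by
  calc ‖a * b - b * a‖ ≤ ‖a * b‖ + ‖b * a‖ := norm_sub_le _ _
    _ ≤ ‖a‖ * ‖b‖ + ‖b‖ * ‖a‖ := add_le_add (norm_mul_le _ _) (norm_mul_le _ _)
    _ = 2 * ‖a‖ * ‖b‖ := by ring

/-- ★ **PIECE (ii), FIRST HALF — `C(F) − C(F′)` IS CHARGED BY MASS × (LEG − TRANSLATE) DIFFERENCES**: for two families of the same length,
`‖C(A) − C(A′)‖ ≤ 2·(Σ_i‖A_i − A′_i‖)·(Σ_i‖A_i‖ + Σ_i‖A′_i‖)` (from `[A_i,A_j] − [A′_i,A′_j] = [A_i − A′_i, A_j] + [A′_i, A_j − A′_j]`).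
[cite: Balaban1985Averaging, (19)-(23) p.21] -/
theorem norm_commSum_sub_commSum_le {m : ℕ} (A A' : Fin m → S) :
    ‖(∑ i : Fin m, ∑ j : Fin m, if i < j then A i * A j - A j * A i else 0)
        - (∑ i : Fin m, ∑ j : Fin m, if i < j then A' i * A' j - A' j * A' i else 0)‖
      ≤ 2 * (∑ i : Fin m, ‖A i - A' i‖) * ((∑ i : Fin m, ‖A i‖) + ∑ i : Fin m, ‖A' i‖) := by
  rw [← Finset.sum_sub_distrib]
  simp_rw [← Finset.sum_sub_distrib]
  have hterm : ∀ i j : Fin m,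
      ‖(if i < j then A i * A j - A j * A i else 0) - (if i < j then A' i * A' j - A' j * A' i else 0)‖
        ≤ 2 * ‖A i - A' i‖ * ‖A j‖ + 2 * ‖A' i‖ * ‖A j - A' j‖ := by
    intro i j
    by_cases h : i < j
    · rw [if_pos h, if_pos h]
      have e : A i * A j - A j * A i - (A' i * A' j - A' j * A' i)
          = ((A i - A' i) * A j - A j * (A i - A' i)) + (A' i * (A j - A' j) - (A j - A' j) * A' i) := by noncomm_ring
      rw [e]
      exact (norm_add_le _ _).trans (add_le_add (norm_comm_le _ _) (norm_comm_le _ _))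
    · rw [if_neg h, if_neg h, sub_zero, norm_zero]
      positivity
  calc ‖∑ i : Fin m, ∑ j : Fin m, ((if i < j then A i * A j - A j * A i else 0) - (if i < j then A' i * A' j - A' j * A' i else 0))‖
      ≤ ∑ i : Fin m, ∑ j : Fin m, (2 * ‖A i - A' i‖ * ‖A j‖ + 2 * ‖A' i‖ * ‖A j - A' j‖) :=
        (norm_sum_le _ _).trans (Finset.sum_le_sum fun i _ => (norm_sum_le _ _).trans (Finset.sum_le_sum fun j _ => hterm i j))
    _ = 2 * (∑ i : Fin m, ‖A i - A' i‖) * (∑ j : Fin m, ‖A j‖) + 2 * (∑ i : Fin m, ‖A' i‖) * (∑ j : Fin m, ‖A j - A' j‖) := by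
        symm
        rw [mul_assoc (2 : ℝ) (∑ i : Fin m, ‖A i - A' i‖), Finset.sum_mul_sum,
          mul_assoc (2 : ℝ) (∑ i : Fin m, ‖A' i‖), Finset.sum_mul_sum, Finset.mul_sum, Finset.mul_sum, ← Finset.sum_add_distrib]
        refine Finset.sum_congr rfl fun i _ => ?_
        rw [Finset.mul_sum, Finset.mul_sum, ← Finset.sum_add_distrib]
        refine Finset.sum_congr rfl fun j _ => ?_
        ring
    _ ≤ 2 * (∑ i : Fin m, ‖A i - A' i‖) * ((∑ i : Fin m, ‖A i‖) + ∑ i : Fin m, ‖A' i‖) := by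
        have h0 : 0 ≤ ∑ i : Fin m, ‖A i - A' i‖ := Finset.sum_nonneg fun _ _ => norm_nonneg _
        have h1 : 0 ≤ ∑ i : Fin m, ‖A' i‖ := Finset.sum_nonneg fun _ _ => norm_nonneg _
        nlinarith [mul_nonneg h0 h1]

/-- **PIECE (ii), SECOND HALF — `[ΣF, ΣF′ − ΣF]`**: `‖ΣA·(ΣA′ − ΣA) − (ΣA′ − ΣA)·ΣA‖ ≤ 2·(Σ_i‖A_i‖)·(Σ_i‖A′_i − A_i‖)`. [cite: Balaban1985Averaging, (19)-(23) p.21] -/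
theorem norm_comm_sub_le {m : ℕ} (A A' : Fin m → S) :
    ‖(∑ i : Fin m, A i) * (∑ i : Fin m, A' i - ∑ i : Fin m, A i) - (∑ i : Fin m, A' i - ∑ i : Fin m, A i) * (∑ i : Fin m, A i)‖
      ≤ 2 * (∑ i : Fin m, ‖A i‖) * (∑ i : Fin m, ‖A' i - A i‖) := by
  rw [← Finset.sum_sub_distrib]
  calc _ ≤ 2 * ‖∑ i : Fin m, A i‖ * ‖∑ i : Fin m, (A' i - A i)‖ := norm_comm_le _ _
    _ ≤ 2 * (∑ i : Fin m, ‖A i‖) * (∑ i : Fin m, ‖A' i - A i‖) := by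
        have h1 := norm_sum_le (Finset.univ : Finset (Fin m)) A
        have h2 := norm_sum_le (Finset.univ : Finset (Fin m)) (fun i => A' i - A i)
        have h3 : 0 ≤ ‖∑ i : Fin m, A i‖ := norm_nonneg _
        have h4 : 0 ≤ ‖∑ i : Fin m, (A' i - A i)‖ := norm_nonneg _
        nlinarith [mul_le_mul h1 h2 h4 ((norm_nonneg _).trans h1)]

/-- **PIECE (iii), CRUDE SIZE — `[ΣF + ΣF′, ΣS]`**: `‖(ΣA + ΣA′)·ΣS − ΣS·(ΣA + ΣA′)‖ ≤ 2·(Σ‖A_i‖ + Σ‖A′_i‖)·‖ΣS‖` — per word this is MASS × (segment sum), NOT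
small; only its mean over the reflected offsets is (consumer's odd-symmetry lemma).  Recorded for the bookkeeping of the remainder after symmetrisation.
[cite: Balaban1987RG1, (0.4) p.253] -/
theorem norm_comm_sum_le {m m' : ℕ} (A : Fin m → S) (A' : Fin m' → S) (T : S) :
    ‖(∑ i : Fin m, A i + ∑ i : Fin m', A' i) * T - T * (∑ i : Fin m, A i + ∑ i : Fin m', A' i)‖
      ≤ 2 * ((∑ i : Fin m, ‖A i‖) + ∑ i : Fin m', ‖A' i‖) * ‖T‖ := by
  calc _ ≤ 2 * ‖∑ i : Fin m, A i + ∑ i : Fin m', A' i‖ * ‖T‖ := norm_comm_le _ _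
    _ ≤ 2 * ((∑ i : Fin m, ‖A i‖) + ∑ i : Fin m', ‖A' i‖) * ‖T‖ := by
        have h := (norm_add_le (∑ i : Fin m, A i) (∑ i : Fin m', A' i)).trans
          (add_le_add (norm_sum_le _ _) (norm_sum_le _ _))
        exact mul_le_mul_of_nonneg_right (mul_le_mul_of_nonneg_left h (by norm_num)) (norm_nonneg _)

end Normed

end Summit.QuantumFields.YangMills.Theorems.Prop7WordCommutatorSplit

end
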